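import Summits.QuantumAdvantage.QuantumAdvantage.Theorems.CharDialColumnDialB2
import HarnessLib

/-!
# CharDial — the SYMMETRIC-BLOCK LAW (part B3): the fibre bound and ★★ `symBlockLaw`

Tree twin, part B3 (§3.7–3.8), of the decomp-qadv lens-5 g34 node `Theses/ColumnDial.lean`; imports part B2.  The fibre bound (`fibre_bound`:
CASE I or CASE II on every fibre of a block of size `≥ 2L+2`), base words (`baseSet`, `card_baseSet`), and the summation over the
`2^(n−|S|)·p` fibres with `p·cos(π/3p)^L ≤ 1/42`, `m₀ = 2L+2`: `#LOSE ≥ 2ⁿ/7`, i.e. ★★ `symBlockLaw : SymBlockLaw`.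
Kernel-checked, no `sorry`, no instances, no notation.  Memo: decomp-qadv-lens-5/g34/NODE-g34.md (§9 proof map, §10 land package); blueprint BLUEPRINT-g34.md.  Re-cut of the staged part B (cf96495d) at section boundaries (≤ 400 lines per file, every declaration docstringed); declaration bodies byte-identical.
-/

set_option autoImplicit false
set_option linter.dupNamespace false

namespace Summit.QuantumAdvantage.QuantumAdvantage.Theorems.ColumnDial

open Finset
open Summit.QuantumAdvantage.AdviceFreeQNC0

section Law

variable {n : ℕ}

/-! #### 3.7 the fibre bound and the summation -/

/-- ★ every fibre `X(z, μ)` of a block of size `≥ 2L+2` loses at least `2^{|S|}/6p − 2^{|S|} cos(π/3p)^L` words. -/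
theorem fibre_bound {p : ℕ} (hp : 1 ≤ p) (h3p : Nat.Coprime 3 p) {S : Finset (Fin n)}
    {y : Fin (n + 1) → (Fin n → Bool) → Bool} (hS : SymBlock p S y) (c : ℕ)
    {z : Fin n → Bool} (hz : ∀ k ∈ S, z k = false) (μ : ZMod p) {L : ℕ} (hL : 2 * L + 2 ≤ S.card) :
    (2 : ℝ) ^ S.card / (6 * p) - (2 : ℝ) ^ S.card * (Real.cos (Real.pi / (3 * p))) ^ L ≤
      (((Xf p S z μ).filter fun u => ringWinU c y u = false).card : ℝ) := by
  obtain ⟨hC0, hC1⟩ := Summit.QuantumAdvantage.AdviceFreeQNC0.JLinPeel.TokenDial.cos_facts hp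
  have hp0 : (0 : ℝ) < p := by exact_mod_cast hp
  have hm : 1 ≤ S.card := by omega
  have hpowL : (Real.cos (Real.pi / (3 * p))) ^ S.card ≤ (Real.cos (Real.pi / (3 * p))) ^ L :=
    pow_le_pow_of_le_one hC0 hC1.le (by omega)
  have herr : (2 * Real.cos (Real.pi / (3 * p))) ^ S.card ≤ (2 : ℝ) ^ S.card * (Real.cos (Real.pi / (3 * p))) ^ L := by
    rw [mul_pow]; exact mul_le_mul_of_nonneg_left hpowL (by positivity)
  have h36 : (2 : ℝ) ^ S.card / (6 * p) ≤ (2 : ℝ) ^ S.card / (3 * p) :=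
    div_le_div_of_nonneg_left (by positivity) (by positivity) (by linarith)
  by_cases hX : (Xf p S z μ).Nonempty
  · obtain ⟨u₀, hu₀⟩ := hX
    by_cases hI : ∀ k, 1 ≤ k → k < S.card → ∀ t, phasePat (fired S y u₀ k) (eZ c S u₀) t = false
    · have h := caseI hp h3p hS c hm hu₀ hI
      linarith
    · push Not at hI
      obtain ⟨a, ha1, ham, t₀, ht₀⟩ := hI
      rcases phasePat_cases (fired S y u₀ a) (eZ c S u₀) with h0 | ⟨ρ, hρ⟩
      · exact absurd (h0 t₀) ht₀
      · exact caseII hp h3p hS c hz hu₀ ha1 ham hρ hL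
  · rw [Finset.not_nonempty_iff_eq_empty] at hX
    have h := fib_two_moduli_ge hp h3p S z μ 0
    have hsub : ((fib S z).filter fun u =>
        ((SubChar.bw S u : ℕ) : ZMod p) = μ ∧ ((SubChar.bw S u : ℕ) : ZMod 3) = 0) ⊆ Xf p S z μ := by
      intro u hu
      rw [Finset.mem_filter] at hu
      exact mem_Xf.2 ⟨hu.1, hu.2.1⟩
    have hc0 : ((((fib S z).filter fun u =>
        ((SubChar.bw S u : ℕ) : ZMod p) = μ ∧ ((SubChar.bw S u : ℕ) : ZMod 3) = 0).card : ℕ) : ℝ) ≤ 0 := by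
      have hc := Finset.card_le_card hsub
      rw [hX, Finset.card_empty] at hc
      exact_mod_cast hc
    rw [hX, Finset.filter_empty, Finset.card_empty, Nat.cast_zero]
    linarith

/-- the base words form a fibre of the complement of the block. -/
theorem baseSet_eq_fib (S : Finset (Fin n)) : baseSet S = fib (univ \ S) (fun _ => false) := by
  ext z
  simp [baseSet, fib, Finset.mem_sdiff]

/-- There are `2 ^ (n − |S|)` base words (words vanishing on `S`). -/
theorem card_baseSet (S : Finset (Fin n)) : (baseSet S).card = 2 ^ (n - S.card) := by
  rw [baseSet_eq_fib, card_fib, Finset.card_univ_sdiff, Fintype.card_fin]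

/-- Zeroing a word on `S` gives a base word. -/
theorem zeroOn_mem_baseSet (S : Finset (Fin n)) (u : Fin n → Bool) : zeroOn S u ∈ baseSet S := by
  refine Finset.mem_filter.2 ⟨Finset.mem_univ _, fun k hk => ?_⟩
  simp [zeroOn, hk]

end Law

/-! #### 3.8 ★★ THE LAW -/

/-- ★★ **`SymBlockLaw` holds**: `m₀(p) = 2L+2` with `cos(π/3p)^L < 1/(42p)`; losers `≥ 2ⁿ/6 − p·cos(π/3p)^L·2ⁿ ≥ 2ⁿ/7`. -/
theorem symBlockLaw : SymBlockLaw := by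
  intro p hp2 hp3
  have hp : 1 ≤ p := by omega
  have h3p : Nat.Coprime 3 p := hp3.symm
  haveI : NeZero p := ⟨by omega⟩
  obtain ⟨hC0, hC1⟩ := Summit.QuantumAdvantage.AdviceFreeQNC0.JLinPeel.TokenDial.cos_facts hp
  have hp0 : (0 : ℝ) < p := by exact_mod_cast hp
  have hpne : (p : ℝ) ≠ 0 := hp0.ne'
  obtain ⟨L, hL⟩ := exists_pow_lt_of_lt_one (show (0 : ℝ) < 1 / (42 * p) by positivity) hC1
  refine ⟨2 * L + 2, fun n c y hy => ?_⟩
  obtain ⟨S, hSm, hS⟩ := hy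
  have hpθ : (p : ℝ) * (Real.cos (Real.pi / (3 * p))) ^ L ≤ 1 / 42 := by
    have h := mul_lt_mul_of_pos_left hL hp0
    have h' : (p : ℝ) * (1 / (42 * p)) = 1 / 42 := by field_simp
    linarith
  -- the losers, fibred over (base word, block weight mod p)
  have hzS : ∀ z ∈ baseSet S, ∀ k ∈ S, z k = false := fun z hz => (Finset.mem_filter.1 hz).2
  have hfib : ((univ : Finset (Fin n → Bool)).filter fun u => ringWinU c y u = false).card =
      ∑ b ∈ baseSet S ×ˢ (univ : Finset (ZMod p)),
        ((((univ : Finset (Fin n → Bool)).filter fun u => ringWinU c y u = false).filter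
          fun u => (zeroOn S u, ((SubChar.bw S u : ℕ) : ZMod p)) = b).card) :=
    Finset.card_eq_sum_card_fiberwise fun u _ =>
      Finset.mem_product.2 ⟨zeroOn_mem_baseSet S u, Finset.mem_univ _⟩
  have hterm : ∀ b ∈ baseSet S ×ˢ (univ : Finset (ZMod p)),
      (2 : ℝ) ^ S.card / (6 * p) - (2 : ℝ) ^ S.card * (Real.cos (Real.pi / (3 * p))) ^ L ≤
        (((((univ : Finset (Fin n → Bool)).filter fun u => ringWinU c y u = false).filter
          fun u => (zeroOn S u, ((SubChar.bw S u : ℕ) : ZMod p)) = b).card) : ℝ) := by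
    rintro ⟨z, μ⟩ hb
    have hz : ∀ k ∈ S, z k = false := hzS z (Finset.mem_product.1 hb).1
    refine (fibre_bound hp h3p hS c hz μ hSm).trans ?_
    have hsub : ((Xf p S z μ).filter fun u => ringWinU c y u = false) ⊆
        ((((univ : Finset (Fin n → Bool)).filter fun u => ringWinU c y u = false).filter
          fun u => (zeroOn S u, ((SubChar.bw S u : ℕ) : ZMod p)) = (z, μ))) := by
      intro u hu
      rw [Finset.mem_filter] at hu
      obtain ⟨huX, hW⟩ := hu
      obtain ⟨huf, hμ⟩ := mem_Xf.1 huX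
      rw [Finset.mem_filter]
      refine ⟨Finset.mem_filter.2 ⟨Finset.mem_univ _, hW⟩, ?_⟩
      rw [zeroOn_eq_of_mem_fib hz huf, hμ]
    exact_mod_cast Finset.card_le_card hsub
  have hcardTn : (baseSet S ×ˢ (univ : Finset (ZMod p))).card = 2 ^ (n - S.card) * p := by
    rw [Finset.card_product, card_baseSet, Finset.card_univ, ZMod.card]
  have hcardT : ((baseSet S ×ˢ (univ : Finset (ZMod p))).card : ℝ) = (2 : ℝ) ^ (n - S.card) * p := by
    exact_mod_cast hcardTn
  have hLOSE : (2 : ℝ) ^ (n - S.card) * p *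
      ((2 : ℝ) ^ S.card / (6 * p) - (2 : ℝ) ^ S.card * (Real.cos (Real.pi / (3 * p))) ^ L) ≤
      ((((univ : Finset (Fin n → Bool)).filter fun u => ringWinU c y u = false).card : ℕ) : ℝ) := by
    rw [← hcardT, hfib, Nat.cast_sum]
    calc ((baseSet S ×ˢ (univ : Finset (ZMod p))).card : ℝ) *
        ((2 : ℝ) ^ S.card / (6 * p) - (2 : ℝ) ^ S.card * (Real.cos (Real.pi / (3 * p))) ^ L)
        = ∑ _b ∈ baseSet S ×ˢ (univ : Finset (ZMod p)),
            ((2 : ℝ) ^ S.card / (6 * p) - (2 : ℝ) ^ S.card * (Real.cos (Real.pi / (3 * p))) ^ L) := by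
          rw [Finset.sum_const, nsmul_eq_mul]
      _ ≤ ∑ b ∈ baseSet S ×ˢ (univ : Finset (ZMod p)),
            (((((univ : Finset (Fin n → Bool)).filter fun u => ringWinU c y u = false).filter
              fun u => (zeroOn S u, ((SubChar.bw S u : ℕ) : ZMod p)) = b).card) : ℝ) := Finset.sum_le_sum hterm
  have hSn : S.card ≤ n := by simpa using S.card_le_univ
  have hpow : (2 : ℝ) ^ (n - S.card) * (2 : ℝ) ^ S.card = (2 : ℝ) ^ n := by
    rw [← pow_add, Nat.sub_add_cancel hSn]
  have h2n : (0 : ℝ) ≤ (2 : ℝ) ^ n := by positivity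
  have hexp : (2 : ℝ) ^ (n - S.card) * p *
      ((2 : ℝ) ^ S.card / (6 * p) - (2 : ℝ) ^ S.card * (Real.cos (Real.pi / (3 * p))) ^ L) =
      (2 : ℝ) ^ n / 6 - (2 : ℝ) ^ n * ((p : ℝ) * (Real.cos (Real.pi / (3 * p))) ^ L) := by
    rw [← hpow]; field_simp; try ring
  have hprod : (2 : ℝ) ^ n * ((p : ℝ) * (Real.cos (Real.pi / (3 * p))) ^ L) ≤ (2 : ℝ) ^ n * (1 / 42) :=
    mul_le_mul_of_nonneg_left hpθ h2n
  -- winners = all words − losers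
  have hsplit := Finset.card_filter_add_card_filter_not (s := (univ : Finset (Fin n → Bool)))
    (fun u => ringWinU c y u = true)
  have hneg : ((univ : Finset (Fin n → Bool)).filter fun u => ¬ ringWinU c y u = true) =
      ((univ : Finset (Fin n → Bool)).filter fun u => ringWinU c y u = false) :=
    Finset.filter_congr fun u _ => by cases ringWinU c y u <;> simp
  rw [hneg, Finset.card_univ, Fintype.card_fun, Fintype.card_bool, Fintype.card_fin] at hsplit
  have hW : ((((univ : Finset (Fin n → Bool)).filter fun u => ringWinU c y u = true).card : ℕ) : ℝ) =
      (2 : ℝ) ^ n - ((((univ : Finset (Fin n → Bool)).filter fun u => ringWinU c y u = false).card : ℕ) : ℝ) := by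
    have h := congrArg (Nat.cast : ℕ → ℝ) hsplit
    push_cast at h
    linarith
  rw [hW]
  linarith

end Summit.QuantumAdvantage.QuantumAdvantage.Theorems.ColumnDial
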